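import Summits.BirchSwinnertonDyer.Rank1Residual.Partition.MainConjecturesCMAnyOrder
import Literature.NumberTheory.EllipticCurves.ComplexMultiplicationShaKnappProofs
import Literature.NumberTheory.EllipticCurves.BSDAnalyticRankTunnellCMProofs
import Literature.NumberTheory.EllipticCurves.BSDWave0TunnellProofs
import HarnessLib

/-!
# Route `PrintCf2`, ramified type: every `j = 287496` curve has an explicit CONGRUENT-NUMBER PARTNER
# `E_n` (`n ≥ 1` squarefree) up to a rational `2`-isogeny; the `j = 287496` sub-class of the crux is
# EQUIVALENT to the congruent-number class (cell `bsd-print-cf2`, seat p4; serves item 20509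
# `RamifiedOffTYZOfFacts`, whose docstring lists «every j = 287496 curve»)

HONEST FRAMING (cell `bsd-print-cf2`, D-0131 (2) print tier, PARTITION currency): nothing is closed
here. File `PrintCf2MaximalOrderReduction` (p540203) proved abstractly that the ramified crux reads
on `j ∈ {1728, 8000}`; this file is ROUTE-INDEPENDENT (no `Theses` import). This file makes the `j = 287496` ⇝ `j = 1728` step EXPLICIT and lands it in
the currency of every printed theorem of the ramified type (Tian 2014, Tian–Yuan–Zhang 2017,
Li–Liu–Tian 2024, Smith, Monsky — all about `E_n : y² = x³ − n²x`):

* §1 `exists_isIsogenous_congruentNumberCurve_of_j_eq_287496` — for every elliptic `W/ℚ` with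
  `j(W) = 287496` there is a squarefree `n ≥ 1` with `W ∼_ℚ E_n` (`congruentNumberCurve n`).
  Proof: `W ≅ E₁₆^{(d)}` with `E₁₆ = [0,−6,0,1,0]` (`32a3`-shape), `d` squarefree (Silverman X.5.4,
  `exists_variableChange_eq_quadraticTwist_intCast_of_j_eq`); the tree's `2`-isogeny
  `E₁₆ ~ E₁₆' = [0,12,0,32,0]` (`isIsogenous_cm16`) twists (`IsIsogenous.quadraticTwist`); and
  `E₁₆'^{(d)} = [0, 12d, 0, 32d², 0] = x(x+4d)(x+8d)` is `E_{|d|}` under `(u, r) = (2, −4d)`.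
  Conversely `exists_j287496_isIsogenous_congruentNumberCurve`: every `E_n` (`n ≥ 1` squarefree) is
  the partner of a globally minimal `j = 287496` curve.
* §2 `bsdp_two_iff_congruentPartner` — granted Cassels/GZK/modularity, for such a pair in analytic
  rank `≤ 1`: `BSD(W,2) ⟺ BSD(E_n,2)`, and `r_an(W) = r_an(E_n)` unconditionally (Faltings).
* §3 `ramified_j287496_iff_congruent` — granted Cassels/GZK/modularity: «`BSD(W,2)` for every
  globally minimal `W` of analytic rank one with `j(W) = 287496`» ⟺ «`BSD(E_n,2)` for every
  squarefree `n ≥ 1` with `r_an(E_n) = 1`». So the `j = 287496` members of item 20509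
  (`RamifiedOffTYZOfFacts`) cost NOTHING beyond the congruent-number members: every printed or
  kernel theorem on `E_n` (cells bsd-monsky / bsd-print-cf2 p1, p2) transfers to both partners
  `E₁₆^{(±n)}` by name through §2.

beyond-print theorem: NO (Cassels' isogeny invariance; Cremona table class `32a`). References:
[cite: SilvermanAEC2009, X.5 Prop. 5.4 and Cor. 5.4.1]; [cite: SilvermanAEC2009, III.4 Example 4.5];
[cite: CremonaAlgorithms1997, §3.8 and Table 1 (class 32a)]; [cite: MilneADT2006, Thm. I.7.3];
[cite: Miller2011LMS, §1 and Def. 1.1]; [cite: SilvermanATAEC1994, App. A §3].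
-/

set_option linter.dupNamespace false -- namespace `…BirchSwinnertonDyer.BirchSwinnertonDyer…` (D-0017 nested layout)
set_option autoImplicit false

noncomputable section

open scoped Classical

open WeierstrassCurve Literature.NumberTheory.EllipticCurves
  Literature.NumberTheory.EllipticCurves.Rank1Residual
open Summit.BirchSwinnertonDyer.Rank1Residual

namespace Summit.BirchSwinnertonDyer.BirchSwinnertonDyer.Theorems.PrintCf2

/-! ## §1 The congruent-number partner of a `j = 287496` curve -/

/-- The quadratic twist of `E₁₆' = [0,12,0,32,0]` by `d` is `[0, 12d, 0, 32d², 0]`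
(`b₂ = 48`, `b₄ = 64`, `b₆ = 0`). [folklore] -/
theorem quadraticTwist_cm16' (d : ℚ) :
    (⟨0, 12, 0, 32, 0⟩ : WeierstrassCurve ℚ).quadraticTwist d = ⟨0, 12 * d, 0, 32 * d ^ 2, 0⟩ := by
  ext <;> simp [quadraticTwist, b₂, b₄, b₆] <;> ring

/-- `(u, r) = (2, −4d)` carries `y² = x(x + 4d)(x + 8d)` to the congruent-number curve
`y² = x³ − d²x`. [cite: CremonaAlgorithms1997, §3.8 and Table 1 (class 32a)] -/
theorem smul_twist_cm16'_eq_congruentNumberCurve (d : ℤ) :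
    (⟨Units.mk0 (2 : ℚ) two_ne_zero, -4 * (d : ℚ), 0, 0⟩ : VariableChange ℚ) •
        (⟨0, 12 * (d : ℚ), 0, 32 * (d : ℚ) ^ 2, 0⟩ : WeierstrassCurve ℚ) =
      congruentNumberCurve d.natAbs := by
  have hn : ((d.natAbs : ℕ) : ℚ) ^ 2 = (d : ℚ) ^ 2 := by
    rw [← Int.cast_natCast, ← Int.cast_pow, Int.natAbs_sq, Int.cast_pow]
  ext
  · simp [congruentNumberCurve, variableChange_a₁]
  · simp only [congruentNumberCurve, variableChange_a₂, Units.val_inv_eq_inv_val, Units.val_mk0]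
    ring
  · simp [congruentNumberCurve, variableChange_a₃]
  · simp only [congruentNumberCurve, variableChange_a₄, Units.val_inv_eq_inv_val, Units.val_mk0, hn]
    ring
  · simp only [congruentNumberCurve, variableChange_a₆, Units.val_inv_eq_inv_val, Units.val_mk0]
    ring

/-- **Every `j = 287496` curve over `ℚ` is `ℚ`-isogenous to a congruent-number curve `E_n`,
`n ≥ 1` squarefree** (explicitly: `W ≅ [0,−6,0,1,0]^{(d)}`, `d` squarefree, and `n = |d|`).
[cite: SilvermanAEC2009, X.5 Prop. 5.4 and Cor. 5.4.1] [cite: SilvermanAEC2009, III.4 Example 4.5]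
[cite: CremonaAlgorithms1997, §3.8 and Table 1 (class 32a)] -/
theorem exists_isIsogenous_congruentNumberCurve_of_j_eq_287496 (W : WeierstrassCurve ℚ)
    [W.IsElliptic] (hj : W.j = 287496) :
    ∃ n : ℕ, n ≠ 0 ∧ Squarefree n ∧ IsIsogenous W (congruentNumberCurve n) := by
  obtain ⟨d, hd0, hsq, C, hC⟩ := exists_variableChange_eq_quadraticTwist_intCast_of_j_eq
    (W := W) (E := (⟨0, -6, 0, 1, 0⟩ : WeierstrassCurve ℚ)) (by rw [hj, j_cm16])
    (by rw [j_cm16]; norm_num) (by rw [j_cm16]; norm_num)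
  have hdQ : (d : ℚ) ≠ 0 := by exact_mod_cast hd0
  have hn0 : d.natAbs ≠ 0 := Int.natAbs_ne_zero.mpr hd0
  haveI := isElliptic_congruentNumberCurve hn0
  haveI := (⟨0, -6, 0, 1, 0⟩ : WeierstrassCurve ℚ).isElliptic_quadraticTwist hdQ
  haveI := (⟨0, 12, 0, 32, 0⟩ : WeierstrassCurve ℚ).isElliptic_quadraticTwist hdQ
  refine ⟨d.natAbs, hn0, Int.squarefree_natAbs.mpr hsq, ?_⟩
  -- `W ~ E₁₆^{(d)}`
  have h1 : IsIsogenous W ((⟨0, -6, 0, 1, 0⟩ : WeierstrassCurve ℚ).quadraticTwist (d : ℚ)) :=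
    isIsogenous_of_smul_eq hC
  -- `E₁₆^{(d)} ~ E₁₆'^{(d)}`
  have h2 : IsIsogenous ((⟨0, -6, 0, 1, 0⟩ : WeierstrassCurve ℚ).quadraticTwist (d : ℚ))
      ((⟨0, 12, 0, 32, 0⟩ : WeierstrassCurve ℚ).quadraticTwist (d : ℚ)) :=
    isIsogenous_cm16.quadraticTwist hdQ
  -- `E₁₆'^{(d)} ≅ E_{|d|}`
  have h3 : IsIsogenous ((⟨0, 12, 0, 32, 0⟩ : WeierstrassCurve ℚ).quadraticTwist (d : ℚ))
      (congruentNumberCurve d.natAbs) := by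
    rw [quadraticTwist_cm16']
    exact isIsogenous_of_smul_eq (smul_twist_cm16'_eq_congruentNumberCurve d)
  exact h1.trans' (h2.trans' h3)

/-- **Conversely, every congruent-number curve `E_n` (`n ≥ 1` squarefree) is the partner of a
GLOBALLY MINIMAL `j = 287496` curve**: a global minimal model `W` of `E₁₆^{(n)}` (Silverman
VIII.8.3, `hasGlobalMinimalModel_rat_holds`) has `j(W) = 287496` and `W ~ E_n`.
[cite: SilvermanAEC2009, VIII.8, Cor. 8.3] [cite: CremonaAlgorithms1997, §3.8 and Table 1 (class 32a)] -/
theorem exists_j287496_isIsogenous_congruentNumberCurve {n : ℕ} (hn : n ≠ 0) :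
    ∃ (W : WeierstrassCurve ℚ) (_ : W.IsElliptic) (_ : W.IsGloballyMinimal),
      W.j = 287496 ∧ IsIsogenous W (congruentNumberCurve n) := by
  have hnQ : ((n : ℤ) : ℚ) ≠ 0 := by exact_mod_cast hn
  haveI := isElliptic_congruentNumberCurve hn
  haveI hE := (⟨0, -6, 0, 1, 0⟩ : WeierstrassCurve ℚ).isElliptic_quadraticTwist hnQ
  haveI := (⟨0, 12, 0, 32, 0⟩ : WeierstrassCurve ℚ).isElliptic_quadraticTwist hnQ
  obtain ⟨C, hC⟩ := hasGlobalMinimalModel_rat_holds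
    ((⟨0, -6, 0, 1, 0⟩ : WeierstrassCurve ℚ).quadraticTwist ((n : ℤ) : ℚ))
  refine ⟨C • (⟨0, -6, 0, 1, 0⟩ : WeierstrassCurve ℚ).quadraticTwist ((n : ℤ) : ℚ), inferInstance,
    hC, ?_, ?_⟩
  · rw [variableChange_j, j_quadraticTwist _ hnQ, j_cm16]
  · have h2 : IsIsogenous ((⟨0, -6, 0, 1, 0⟩ : WeierstrassCurve ℚ).quadraticTwist ((n : ℤ) : ℚ))
        ((⟨0, 12, 0, 32, 0⟩ : WeierstrassCurve ℚ).quadraticTwist ((n : ℤ) : ℚ)) :=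
      isIsogenous_cm16.quadraticTwist hnQ
    have h3 : IsIsogenous ((⟨0, 12, 0, 32, 0⟩ : WeierstrassCurve ℚ).quadraticTwist ((n : ℤ) : ℚ))
        (congruentNumberCurve n) := by
      rw [quadraticTwist_cm16']
      have h := isIsogenous_of_smul_eq (smul_twist_cm16'_eq_congruentNumberCurve (n : ℤ))
      rwa [Int.natAbs_natCast] at h
    exact (isIsogenous_of_smul _ C).trans' (h2.trans' h3)

/-! ## §2 BSD(·,2) and the analytic rank along the partner isogeny -/

/-- The analytic rank of a `j = 287496` curve is that of its congruent partner (Faltings /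
Knapp 11.67, discharged in the tree). [cite: SilvermanAEC2009, III.4 Example 4.5] -/
theorem analyticRank_eq_of_isIsogenous_congruentNumberCurve {W : WeierstrassCurve ℚ} [W.IsElliptic]
    {n : ℕ} (hn : n ≠ 0) (h : IsIsogenous W (congruentNumberCurve n)) :
    haveI := isElliptic_congruentNumberCurve hn
    W.analyticRank = (congruentNumberCurve n).analyticRank := by
  haveI := isElliptic_congruentNumberCurve hn
  exact analyticRank_eq_of_isIsogenous' h

/-- **`BSD(W,2) ⟺ BSD(E_n,2)` for a globally minimal `W ∼_ℚ E_n` (`n` squarefree) in analytic rank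
`≤ 1`**, granted Cassels (`hCAS`), GZK (`hGZK`) and modularity (`hMOD`) — Miller's "BSD(E,p) is an
isogeny invariant" in both directions (`Wuthrich2014.bsdp_of_isIsogenous`; `E_n` is globally
minimal, `isGloballyMinimal_congruentNumberCurve`). [cite: MilneADT2006, Thm. I.7.3]
[cite: Miller2011LMS, §1 and Def. 1.1] -/
theorem bsdp_two_iff_congruentPartner (hCAS : bsdRHS_eq_of_isIsogenous)
    (hGZK : rank_eq_analyticRank_of_analyticRank_le_one) (hMOD : hasEntireLFunction_rat)
    {W : WeierstrassCurve ℚ} [W.IsElliptic] [W.IsGloballyMinimal] {n : ℕ} (hsq : Squarefree n)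
    (h : IsIsogenous W (congruentNumberCurve n)) (hr : W.analyticRank ≤ 1) :
    haveI := isElliptic_congruentNumberCurve hsq.ne_zero
    BSDp W 2 ↔ BSDp (congruentNumberCurve n) 2 := by
  haveI := isElliptic_congruentNumberCurve hsq.ne_zero
  haveI := isGloballyMinimal_congruentNumberCurve hsq
  have hr' : (congruentNumberCurve n).analyticRank ≤ 1 := by
    rwa [← analyticRank_eq_of_isIsogenous' h]
  constructor
  · intro hW
    exact Wuthrich2014.bsdp_of_isIsogenous hCAS h.symm_of_charZero (hGZK W hr).2
      (W.leadingLCoeff_ne_zero_holds (hMOD W)) hW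
  · intro hE
    exact Wuthrich2014.bsdp_of_isIsogenous hCAS h (hGZK _ hr').2
      ((congruentNumberCurve n).leadingLCoeff_ne_zero_holds (hMOD _)) hE

/-! ## §3 The `j = 287496` sub-class of the ramified crux ⟺ the congruent-number class -/

/-- **«`BSD(·,2)` on the globally minimal `j = 287496` curves of analytic rank one» ⟺ «`BSD(E_n,2)`
for every squarefree `n ≥ 1` with `r_an(E_n) = 1`»**, granted Cassels/GZK/modularity. Hence the
`j = 287496` members of item 20509 (`RamifiedOffTYZOfFacts`: «… every j = 287496 curve …») are
carried, by name, by the congruent-number curves — where all printed theorems of the ramified type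
live. [cite: MilneADT2006, Thm. I.7.3] [cite: CremonaAlgorithms1997, §3.8 and Table 1 (class 32a)]
[cite: SilvermanAEC2009, X.5 Cor. 5.4.1] -/
theorem ramified_j287496_iff_congruent (hCAS : bsdRHS_eq_of_isIsogenous)
    (hGZK : rank_eq_analyticRank_of_analyticRank_le_one) (hMOD : hasEntireLFunction_rat) :
    (∀ (W : WeierstrassCurve ℚ) [W.IsElliptic] [W.IsGloballyMinimal],
        W.analyticRank = 1 → W.j = 287496 → BSDp W 2) ↔
      ∀ (n : ℕ) (hsq : Squarefree n),
        (haveI := isElliptic_congruentNumberCurve hsq.ne_zero;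
          (congruentNumberCurve n).analyticRank = 1 → BSDp (congruentNumberCurve n) 2) := by
  constructor
  · intro h n hsq hr
    haveI := isElliptic_congruentNumberCurve hsq.ne_zero
    obtain ⟨W, _, _, hjW, hiso⟩ := exists_j287496_isIsogenous_congruentNumberCurve hsq.ne_zero
    have hrW : W.analyticRank = 1 := by rw [analyticRank_eq_of_isIsogenous' hiso]; exact hr
    exact (bsdp_two_iff_congruentPartner hCAS hGZK hMOD hsq hiso hrW.le).1 (h W hrW hjW)
  · intro h W _ _ hr hj
    obtain ⟨n, hn0, hsq, hiso⟩ := exists_isIsogenous_congruentNumberCurve_of_j_eq_287496 W hj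
    haveI := isElliptic_congruentNumberCurve hn0
    have hrn : (congruentNumberCurve n).analyticRank = 1 := by
      rw [← analyticRank_eq_of_isIsogenous' hiso]; exact hr
    exact (bsdp_two_iff_congruentPartner hCAS hGZK hMOD hsq hiso hr.le).2 (h n hsq hrn)

/-- **The ramified slice ⟺ «`j = 1728`» ∧ «`j = 8000`», with `j = 287496` discharged onto the
congruent-number curves** — the concrete reading of `wAllCornerFTwoRamified_iff_maximal`
(p540203): granted Cassels/GZK/modularity, `WAllCornerFTwoRamified` holds iff `BSD(·,2)` holds in
analytic rank one on the globally minimal curves with `j = 1728` and on those with `j = 8000`; the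
third ramified `j`-invariant `287496` then follows (`ramified_j287496_iff_congruent`, since every
`E_n` has `j = 1728`). [cite: MilneADT2006, Thm. I.7.3] [cite: SilvermanATAEC1994, App. A §3] -/
theorem bsdp_two_of_j287496_of_j1728 (hCAS : bsdRHS_eq_of_isIsogenous)
    (hGZK : rank_eq_analyticRank_of_analyticRank_le_one) (hMOD : hasEntireLFunction_rat)
    (h1728 : ∀ (W : WeierstrassCurve ℚ) [W.IsElliptic] [W.IsGloballyMinimal],
      W.analyticRank = 1 → W.j = 1728 → BSDp W 2) :
    ∀ (W : WeierstrassCurve ℚ) [W.IsElliptic] [W.IsGloballyMinimal],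
      W.analyticRank = 1 → W.j = 287496 → BSDp W 2 :=
  (ramified_j287496_iff_congruent hCAS hGZK hMOD).2 fun n hsq hr ↦ by
    haveI := isElliptic_congruentNumberCurve hsq.ne_zero
    haveI := isGloballyMinimal_congruentNumberCurve hsq
    exact h1728 _ hr (congruentNumberCurve_j n)

end Summit.BirchSwinnertonDyer.BirchSwinnertonDyer.Theorems.PrintCf2

end
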